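import Summits.ResolutionOfSingularities.ResolutionOfSingularities.Theorems.FrobeniusClosingPatchingRelPerfectDepthMixedFormatB
import HarnessLib

/-!
# Chain W5.2 — F6 STAGE 2 («separation of two regular hypersurfaces»): the X-side format
# `SepFormat i K N 𝒟` — the instance `Q` of `StepSepOne` / `TowerSep` / `EndTwoMonomialSep`

[OURS · L1 W5.2 · res-D-pv-016 AS res-L1-w52-stub-5, T6-X2 OWNER by res-L1-w52-plan-1's RULINGS 2026-08-27T09:17:34Z
(3); written against TargetsF6 part S v0 `ChainW52TargetsF6Sep_v0.lean` sha16 078cf7ab7ff40414 (§2 docstring of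
`StepSepOne`: «intended instance `TwoHyp`») and F6-DESIGN-MEMO c3041ebc §2.3–§2.4, §5 (W1)–(W4).]  NOT a statement of
the manuscript under review (Hironaka 2017); AI-written, weaker than expert review; fact-free.

THE STATE of stage 2 is `(E, X, i, K, N)` (res-D-pv-052's monomial-contact invariant `DepthInvariantMono 2`) with the
E-side N-exponent list `𝒟`.  The format records the X-side objects the END reads:

* a GLOBAL HOST `𝓗`, an effective Cartier divisor (the hypersurface `H = V(𝓗)`), and the X-side list `𝒩` of
  N-CHARGED EXCEPTIONAL DIVISORS with exponents, ALIGNED with `𝒟` through the traces (`𝒩.map (·|_E, id) = 𝒟`), every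
  member effective Cartier;
* the two GLOBAL identities `K = 𝓗 ⊔ (Π G^{a_G}) · 𝓘_E²` and `N = Π G^{a_G}` (res-D-pv-052's `HostMonoFormat 2 i K 𝓗 N`
  with the monomial made explicit; BGMW §4 Step 2a, Kollár (3.111) Step 3) — NO reduced host, NO host exponents, NO
  retraction / cylinder (stage 2 forgets the flag: res-L1-w52-plan-1 09:09:26Z «state = (𝔟, 𝒟) only»);
* `HasSNC (𝓘_E :: boundaryOf 𝒩)` GLOBALLY on `X` (`E` and the exceptional divisors cross normally; Kollár 3.85);
* **HOST REGULAR ALONG `E`**: at every point of `H ∩ i(E)` the host has a generator outside `𝔪²`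
  (`DepthSNC.SNCWithAt [𝓗] ⊤`), i.e. `H` is regular there — the output of STAGE 1 (memo §1 KEY OBSERVATION,
  res-L1-w52-stub-1's `not_mem_sq_of_flag`, p518040) and an invariant of stage 2 (a weight-one blowing up along a
  regular centre `C ⊆ H ∩ E` transports it: this file's owner's `stepSepOne_holds`, next);
* **TRANSVERSALITY AT CHARGED COINCIDENCES**: wherever the trace `𝔟 = K|_E = 𝓗|_E` coincides near `z` with the trace
  of an N-CHARGED member `G` (`(G|_E)_z = 𝔟_z`), the host crosses `G` normally at `i z` (`SNCWithAt [𝓗, G] ⊤`; memo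
  (W3): writing `F = u·w_G + t·g`, this is «`g(i z)` is a unit»; born over centre points of order `≥ 2`, where `H` is
  tangent to `E`, and needed to keep the pockets snc when such a point becomes a centre point);
* res-D-pv-009's **POCKET field**: at every cosupport point of `K` off `i(E)` the END family `𝓗 :: 𝓘_E :: charged`
  has simple normal crossings (`DepthSNC.SNCWithAt`, p510013; stepped by `pocketSNC_step_host`, p514868).

PROVED here (small API; the step `stepSepOne_holds : StepSepOne SepFormat`, the END half and the BRIDGE from stage 1
are separate files): `SepFormat.comap_eq` (`K|_E = 𝓗|_E`), `SepFormat.comap_mono_eq` (`N|_E = Π (G|_E)^{a_G}`),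
`SepFormat.hostMonoFormat`, `SepFormat.ker_sq_le` and **`SepFormat.initial_of_hostMonoFormat`** — the X-half of the
bridge `initialSep_of_endFlag`: a state `K = 𝓗 ⊔ 𝓘_E²` (`HostMonoFormat 2 i K 𝓗 ⊤`) whose host is regular along
`E` is in the format with `N = ⊤`, `𝒟 = []` (boundary `[𝓘_E]` snc by res-D-pv-052's `MixedFormatB.hasSNC_ker`,
pockets vacuous by res-D-pv-009's `pocketSNC_initial`).

## References
* E. Bierstone, D. Grigoriev, P. Milman, J. Włodarczyk, arXiv:1206.3090, Def. 3.1.3, §3.2 Lemma 3.2.1, §4 Step 2a/2b.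
  [BierstoneGrigorievMilmanWlodarczyk2011]
* J. Kollár, *Lectures on Resolution of Singularities* (2007), (3.111) Steps 1–3, Cor. 3.85, Def. 3.24–3.25.
  [Kollar2007]
* H. Matsumura, *Commutative Ring Theory* (1986), Thm. 14.2. [Matsumura1987]
-/

-- `Summit.<Summit>.<Sub>.Theorems` with `Sub = Summit` (single-conjunct summit, D-0017)
set_option linter.dupNamespace false

noncomputable section

open CategoryTheory CategoryTheory.Limits AlgebraicGeometry TopologicalSpace
open Literature.AlgebraicGeometry.Resolution
open Scheme.IdealSheafData

namespace Summit.ResolutionOfSingularities.ResolutionOfSingularities.Theorems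

universe u

namespace DepthGraded

/-- [OURS · L1 W5.2] **The stage-2 X-side format `SepFormat i K N 𝒟`** («two regular hypersurfaces with charged
exceptional boundary»; the instance `Q` of res-L1-w52-plan-1's `StepSepOne` / `TowerSep` / `EndTwoMonomialSep`): a
global effective Cartier HOST `𝓗` and an X-side list `𝒩` of effective Cartier divisors with exponents, aligned
with the E-side N-exponent list `𝒟` through the traces, such that `K = 𝓗 ⊔ (monomialIdeal 𝒩) · 𝓘_E²`,
`N = monomialIdeal 𝒩`, `𝓘_E :: boundaryOf 𝒩` is a simple-normal-crossings divisor of `X`, the host is REGULAR at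
every point of `H ∩ i(E)`, the host is TRANSVERSAL to every N-charged member whose trace coincides with the host
trace near a point, and the END family `𝓗 :: 𝓘_E :: charged` has simple normal crossings at every cosupport point
of `K` off `i(E)` (pockets).  (Strict-implicit `⦃E X⦄` so that `SepFormat` IS a term of plan-1's format type
`∀ ⦃E X⦄, (E ⟶ X) → X.IdealSheafData → X.IdealSheafData → List (E.IdealSheafData × ℕ) → Prop`.)
[cite: BierstoneGrigorievMilmanWlodarczyk2011, §4 Step 2a] [cite: Kollar2007, (3.111) Step 3, Cor. 3.85] -/
def SepFormat ⦃E X : Scheme.{u}⦄ (i : E ⟶ X) (K N : X.IdealSheafData) (𝒟 : List (E.IdealSheafData × ℕ)) :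
    Prop :=
  ∃ (𝓗 : X.IdealSheafData) (𝒩 : List (X.IdealSheafData × ℕ)),
    IsEffectiveCartier 𝓗 ∧ (∀ G ∈ boundaryOf 𝒩, IsEffectiveCartier G) ∧
    𝒩.map (fun p => (p.1.comap i, p.2)) = 𝒟 ∧
    K = 𝓗 ⊔ monomialIdeal 𝒩 * i.ker ^ 2 ∧ N = monomialIdeal 𝒩 ∧
    HasSNC (i.ker :: boundaryOf 𝒩) ∧
    (∀ z : E, i.base z ∈ 𝓗.support → DepthSNC.SNCWithAt [𝓗] ⊤ (i.base z)) ∧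
    (∀ p ∈ 𝒩, 0 < p.2 → ∀ z : E, z ∈ (p.1.comap i).support →
      stalkIdeal (p.1.comap i) z = stalkIdeal (K.comap i) z → DepthSNC.SNCWithAt [𝓗, p.1] ⊤ (i.base z)) ∧
    (∀ x : X, x ∈ K.support → x ∉ Set.range i.base →
      DepthSNC.SNCWithAt (𝓗 :: i.ker :: boundaryOf (𝒩.filter fun p => 0 < p.2)) ⊤ x)

namespace SepFormat

variable {E X : Scheme.{u}} {i : E ⟶ X} {K N : X.IdealSheafData} {𝒟 : List (E.IdealSheafData × ℕ)}

/-- The format is res-D-pv-052's host-mono format of weight two, with host `𝓗`. [folklore] -/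
theorem hostMonoFormat (h : SepFormat i K N 𝒟) : ∃ 𝓗 : X.IdealSheafData, HostMonoFormat 2 i K 𝓗 N := by
  obtain ⟨𝓗, 𝒩, h𝓗, -, -, hK, hN, -⟩ := h
  exact ⟨𝓗, h𝓗, by rw [hK, hN]⟩

/-- Monomial contact: `N · 𝓘_E² ≤ K`. [folklore] -/
theorem mul_ker_sq_le (h : SepFormat i K N 𝒟) : N * i.ker ^ 2 ≤ K := by
  obtain ⟨𝓗, h𝓗⟩ := h.hostMonoFormat
  exact h𝓗.mul_ker_pow_le

/-- **The N-trace**: `N|_E = monomialIdeal 𝒟`. [folklore] -/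
theorem comap_mono_eq (h : SepFormat i K N 𝒟) : N.comap i = monomialIdeal 𝒟 := by
  obtain ⟨𝓗, 𝒩, -, -, h𝒩, -, hN, -⟩ := h
  rw [hN, MixedFormatB.comap_monomialIdeal_eq, h𝒩]

/-- **The host trace is the E-side datum**: for the host `𝓗` of a formatted state, `K|_E = 𝓗|_E` (the monomial
summand `N · 𝓘_E²` restricts to zero). [cite: BierstoneGrigorievMilmanWlodarczyk2011, §4 Step 2a] -/
theorem comap_eq_of_eq [IsClosedImmersion i] {𝓗 : X.IdealSheafData} {𝒩 : List (X.IdealSheafData × ℕ)}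
    (hK : K = 𝓗 ⊔ monomialIdeal 𝒩 * i.ker ^ 2) : K.comap i = 𝓗.comap i := by
  rw [hK, Scheme.IdealSheafData.comap_sup, comap_mul, comap_pow, comap_ker_self,
    ← Scheme.IdealSheafData.zero_eq_bot, zero_pow two_ne_zero, mul_zero, Scheme.IdealSheafData.zero_eq_bot,
    sup_bot_eq]

/-- The host trace is the E-side datum (existential form). [folklore] -/
theorem exists_comap_eq [IsClosedImmersion i] (h : SepFormat i K N 𝒟) :
    ∃ 𝓗 : X.IdealSheafData, HostMonoFormat 2 i K 𝓗 N ∧ K.comap i = 𝓗.comap i ∧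
      ∀ z : E, i.base z ∈ 𝓗.support → DepthSNC.SNCWithAt [𝓗] ⊤ (i.base z) := by
  obtain ⟨𝓗, 𝒩, h𝓗, -, -, hK, hN, -, hreg, -⟩ := h
  exact ⟨𝓗, ⟨h𝓗, by rw [hK, hN]⟩, comap_eq_of_eq hK, hreg⟩

/-! ## The initial state of stage 2 (X-half of the bridge `initialSep_of_endFlag`) -/

/-- [OURS · L1 W5.2] **A host state with unit monomial whose host is regular along `E` is in the format**
(`N = ⊤`, `𝒟 = []`): `X` regular locally Noetherian, `E` regular, `i` a closed immersion with `ker i` an effective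
Cartier divisor, `K = 𝓗 ⊔ 𝓘_E²` with `𝓗` effective Cartier (`HostMonoFormat 2 i K 𝓗 ⊤`) and `H` regular at every
point of `H ∩ i(E)`.  The boundary `[𝓘_E]` is snc (res-D-pv-052's `MixedFormatB.hasSNC_ker`), transversality is
vacuous, and so is the pocket field (`𝓘_E² ≤ K` keeps the cosupport inside `i(E)`: res-D-pv-009's
`pocketSNC_initial`).  The END of stage 1 supplies the regularity (res-L1-w52-stub-1's `not_mem_sq_of_flag`, over
res-L1-w52-lead-1's `FlagFormat`). [cite: Kollar2007, (3.111) Step 3] [cite: Matsumura1987, Thm. 14.2] -/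
theorem initial_of_hostMonoFormat [IsLocallyNoetherian X] [IsClosedImmersion i] (hX : Scheme.IsRegular X)
    (hE : Scheme.IsRegular E) (hker : IsEffectiveCartier i.ker) {𝓗 : X.IdealSheafData}
    (hfmt : HostMonoFormat 2 i K 𝓗 ⊤)
    (hreg : ∀ z : E, i.base z ∈ 𝓗.support → DepthSNC.SNCWithAt [𝓗] ⊤ (i.base z)) :
    SepFormat i K ⊤ [] := by
  obtain ⟨h𝓗, hK⟩ := hfmt
  have hK' : K = 𝓗 ⊔ monomialIdeal ([] : List (X.IdealSheafData × ℕ)) * i.ker ^ 2 := by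
    rw [monomialIdeal_nil, hK]
  have hkerK : i.ker ^ 2 ≤ K := by
    rw [hK, Scheme.IdealSheafData.top_mul]
    exact le_sup_right
  refine ⟨𝓗, [], h𝓗, ?_, rfl, hK', (monomialIdeal_nil).symm, ?_, hreg, ?_, ?_⟩
  · intro G hG; simp [boundaryOf] at hG
  · exact MixedFormatB.hasSNC_ker i hX hE hker
  · intro p hp; simp at hp
  · simpa using DepthSNC.pocketSNC_initial hkerK (𝓗 :: i.ker :: boundaryOf ([] : List (X.IdealSheafData × ℕ)))

end SepFormat

end DepthGraded

end Summit.ResolutionOfSingularities.ResolutionOfSingularities.Theorems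

end
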